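import Summits.FinalStateConjecture.FinalStateConjecture.Theorems.ZeroEnergyKerrOrBombStationaryLimitReductionKerrIsometryRigidityWave3Facts
import Summits.FinalStateConjecture.FinalStateConjecture.Theorems.ZeroEnergyKerrOrBombStationaryLimitReductionKerrIsometryRigidityWave3ChartMap
import Literature.Geometry.Lorentzian.KerrHyperboloidalLeaves
import HarnessLib

/-!
# Route ZeroEnergyKerrOrBomb · crux `FinalStateFromKerrOrBomb` (stmt-FinalStateConjecture-17839), line
# `SketchIdeator1` — stub 1R-F3 `stub_kerrHorizonExtension`: the INTRINSIC reduction
# (`KerrHorizonExtension` from an extension of `Ψ` across Kerr's future horizon as a map INTO `𝓑`)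

Helper file (`--supports stmt-FinalStateConjecture-17839`; registered helper
`kerrHorizonExtension_of_intrinsicExtension`) of the lead's wave-3 stub-worker W14 for
`stub_kerrHorizonExtension : SigM.stub_kerrHorizonExtension := KerrHorizonExtension` (F3 of stub 1R,
`…KerrIsometryRigidityWave3Facts`; lead prover-line-stmt-FinalStateConjecture-17839-0, 2026-08-17).
Companion of the wave-2 chart-level reduction `kerrHorizonExtension_of_boundaryRegularity` (p138126).

**What F3 says.** For a telescope hole `𝓑` (`InTelescope`), `I⁺`-regular, read in a horizon-covering
asymptotically Cartesian adapted chart `A`, a future-normalised `T`-equivariant injective isometric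
immersion `Ψ` of the sub-extremal Kerr exterior onto the d.o.c. (`dΨ (∂_{t*}) = c T`, `c > 0`) extends
to `Φ : {r > r₀} → 𝓑` (`r₋ < r₀ < r₊`, ingoing Kerr–Schild region), `C^∞`, injective, valued in
`range A`, infinitesimally `T`-equivariant, equal to `Ψ` on `{r > r₊}`.

**Robustness audit against the tree's definitions (wave 3, this worker; details in the lead's
`work/stubs/F3-audit.md`).** The candidate counterexamples "Kerr with part of the future horizon
missing" do NOT satisfy the hypotheses: (c1) the ingoing Kerr–Schild region of Kerr `(M, a)` with a
closed `T`-invariant proper subset `Z = ℝ × Z₀` of `𝓗⁺ = {r = r₊}` removed from the carrier has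
`𝓔⁺ = 𝓗⁺ ∖ Z` (`StationaryAFBlackHole.horizon` is DERIVED, `Stationary.lean` `def horizon`, not a
field), and fails `IsIPlusRegular` (`IPlusRegular.lean`): the cross-section `∂S̄ = S̄ ∖ S` of any
`IPlusRegularHypersurface` lies in the compact `K` (fields `closure_eq`, `isCompact_K`), hence in a
compact subset of `E4 ∖ Z`, while `isCrossSection` forces it to meet generators of `𝓗⁺ ∖ Z`
accumulating at `Z` (`a = 0`, or `Z₀` a union of latitude circles) or the infinitely many bounded
pieces, unbounded in `t*`, into which `Z` cuts the winding generators `t* ↦ (t*, θ, φ + Ω_H t*)`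
(`a ≠ 0`) — contradiction; independently it fails `InTelescope` clause 4 (global hyperbolicity
of the CARRIER `M ∖ Z`: for `z ∈ Z ∩ cl(𝓗⁺ ∖ Z)` and `p` just outside `𝓗⁺` on the transverse null
geodesic through `z`, the causal future `J⁺(p; M ∖ Z)` misses the point `x` just inside on that
geodesic but contains points `xₙ → x` reached through the lens `I⁺(p) ∩ I⁻(xₙ) ∩ (𝓗⁺ ∖ Z) ≠ ∅`, so
`J⁺(p)` is not closed, against `IsGloballyHyperbolic.isClosed_causalFuture_singleton`) and, when `Z`
separates `𝓗⁺`, `IsConnected 𝓑.horizon` (clause 2). (c1') Removing all of `𝓗⁺` gives `𝓔⁺ = ∅`,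
killed by `IsConnected 𝓑.horizon` (`InTelescope` clause 2; `IsConnected` entails `Nonempty`) and
again by `IsIPlusRegular` (a closed boundaryless `S = K ∪ AF ends` in block I is a graph along the
complete timelike ZAMO congruence over an open subset `Ω` of `{t_BL = 0} ≅ S² × (r₊, ∞)`; AF ends have
`r → ∞` at infinity because the Kerr Weyl invariant `48 M²/(r − i a cos θ)⁶` does not tend to `0` at
bounded `r`, so `Ω` is also closed, `Ω = {t_BL = 0}`, and `S` reaches `r ↓ r₊` outside every compact
subset of block I — contradiction); a disconnected carrier "exterior ⊔ interior" is excluded by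
`LorentzianManifold.connectedSpace`. (c2) "a freely chosen `horizon` field" does not exist (the
horizon is `∂I⁻(M_ext) ∩ I⁺(M_ext)` by definition). (c3) the time-reversed presentation is excluded
by `0 < c` (wave 2). So F3 survives the audit — no reshaping to an `InTelescopeModT` variant is
called for; whether F3 holds for EVERY admissible `𝓑` is exactly the residual F3a″ below.

**What is proved here.** `kerrHorizonExtension_of_intrinsicExtension`: IF (F3a″, stated inline as
a premise, chart-free data) under the hypotheses of F3 there are `r₁ < r₊` and `Φ₀ : E4 → 𝓑` which on
`Kerr.region a r₁` is `C^∞`, injective, infinitesimally `T`-equivariant (`dΦ₀ e₀ = c T ∘ Φ₀`), equal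
to `Ψ` on the exterior, and sends the horizon `{r = r₊}` into `𝓑.horizon = 𝓔⁺`, THEN
`KerrHorizonExtension`. The only work is `Φ₀ {r > r₀} ⊆ range A` on a thinner collar:
(1) `𝓔⁺ ⊆ range A` (hypothesis) and `range A` is open (`A` is an open embedding), so the collar
lemma (`exists_collar_mem'`: Bolzano–Weierstrass on the compact slice `{x⁰ = 0, r = r₊}`, continuity
of `Φ₀`) charts a slice collar `{x⁰ = 0, r₊ − ε < r ≤ r₊}`; (2) TIME SPREADING without a flow API:
`s ↦ Φ₀ (x + (s/c) e₀)` and the chart line `s ↦ A (u + s e₀)`, `A u = Φ₀ x`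
(`isMIntegralCurve_adaptedChart_line`), are whole-line integral curves of the `C¹` Killing field
`T` through the same point, hence equal (Mathlib `isMIntegralCurve_Ioo_eq_of_contMDiff_boundaryless`,
Hausdorff boundaryless carrier), so `Φ₀ x ∈ range A ⇒ Φ₀ (x + s e₀) ∈ range A`; (3) exterior
points are charted because `Ψ (exterior) = doc ⊆ range A`. With
`r₀ := max (r₁, (r₋ + r₊)/2, r₊ − ε)` all clauses of F3 follow by restriction. The residual of F3
is exactly F3a″ (the `C⁰`-and-`C^∞` boundary regularity of the d.o.c. isometry at `𝓔⁺` plus an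
injective equivariant continuation into the black-hole side), NOT in print as a theorem. Located
ingredients: the `𝓑`-side structure of `𝓔⁺` under `I⁺`-regularity — a compact Lipschitz
cross-section `S₀` transverse to `K₀` and to the generators with `𝓔⁺ = ⋃ₜ φₜ(S₀)` (Chruściel–Costa
arXiv:0806.0016, Prop. 4.1) and smoothness of `𝓔⁺` (ibid., Thm. 4.11); for the `C⁰ ⇒ C^∞` half,
local isometries carry geodesics to geodesics and `Ψ ∘ exp_p = exp_{Ψ p} ∘ dΨ_p` wherever the left
side is defined, "the domain of `γ_{dΨ v}` may be larger" (O'Neill 1983, Ch. 3, Cor. 3.61 (3)–(4),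
pp. 90–91), which writes the extension along the ingoing principal null congruence as
`exp^𝓑 ∘ dΨ ∘ (exp^{Kerr})⁻¹` as soon as the image null geodesics `Ψ ∘ ν_q` are future-extendible in
`𝓑` past the horizon parameter — the genuinely missing `C⁰` statement.

References: P. T. Chruściel, J. L. Costa, arXiv:0806.0016, Def. 1.1, §2.2, §4.1–4.3 (Prop. 4.1–4.8,
Thm. 4.11); B. O'Neill, *Semi-Riemannian Geometry* (1983), Ch. 1 (Thm. 1.16, p. 29), Ch. 3
(pp. 58–59, 90–91), Ch. 9 (Prop. 9.30); J. M. Lee, *Introduction to Smooth Manifolds* (2013),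
Thm. 9.12 (flows), Prop. 3.9; S. W. Hawking, G. F. R. Ellis, *The large scale structure of
space-time* (1973), §6.4 (Prop. 6.4.7), §6.6.
-/

set_option linter.dupNamespace false

noncomputable section

open scoped Manifold ContDiff Topology
open Set Filter Function

namespace Summit.FinalStateConjecture.FinalStateConjecture.Theorems.SymplecticDualOfTheBomb

open Summit.FinalStateConjecture.FinalStateConjecture.Theorems.OneLockedExplosion
open Literature.Geometry.Lorentzian Literature.Geometry.Manifold

/-! ## §1 The collar lemma (codomain an arbitrary topological space) -/

/-- `‖x⃗‖² ≤ r² + a²` for the Kerr–Schild radius (`r² = ((ρ² − a²) + √((ρ² − a²)² + 4a²z²))/2` and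
`√(⋯) ≥ |ρ² − a²|`; Visser arXiv:0706.0622, (35)). Private copy of the wave-2 lemma (p138126, module
unbuilt today). [folklore] -/
private theorem sq_spatialNorm_le_radius_sq_add_w3 (a : ℝ) (x : E4) :
    E4.spatialNorm x ^ 2 ≤ Kerr.radius a x ^ 2 + a ^ 2 := by
  rw [Kerr.radius_sq]
  linarith [Kerr.abs_le_sqrt_radius_discr a x, le_abs_self (E4.spatialNorm x ^ 2 - a ^ 2)]

/-- **Collar lemma** (codomain a topological space `Y`). Let `Θ : E4 → Y` be continuous on the
Kerr–Schild region `{r > max r₁ 0}` with `max r₁ 0 < r_p`, and let `W ⊆ Y` be open with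
`Θ {r = r_p} ⊆ W`. Then for some `ε > 0` every slice point `(0, y)` with `r_p − ε < r (0, y) ≤ r_p`
has `Θ (0, y) ∈ W`: otherwise slice points `(0, yₙ)`, `r_p − 1/(n+1) < r ≤ r_p`, `Θ (0, yₙ) ∉ W`,
bounded by `‖y‖² ≤ r² + a²`, have a subsequence converging (Bolzano–Weierstrass) to `(0, y₀)` with
`r (0, y₀) = r_p`, where `Θ (0, y₀) ∈ W` and `Θ` is continuous — contradicting the openness of `W`.
Private copy (codomain generalised from `E4`) of `exists_collar_mem` (p138126, unbuilt today).
[folklore] -/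
private theorem exists_collar_mem' {Y : Type*} [TopologicalSpace Y] {a r₁ rp : ℝ} {Θ : E4 → Y}
    {W : Set Y} (hW : IsOpen W) (hr₁ : max r₁ 0 < rp)
    (hΘc : ContinuousOn Θ (Kerr.region a r₁ : Set E4))
    (hhor : ∀ x ∈ (Kerr.region a r₁ : Set E4), Kerr.radius a x = rp → Θ x ∈ W) :
    ∃ ε : ℝ, 0 < ε ∧ ∀ y : E3, rp - ε < Kerr.radius a (E4.ofTimeSpace 0 y) →
      Kerr.radius a (E4.ofTimeSpace 0 y) ≤ rp → Θ (E4.ofTimeSpace 0 y) ∈ W := by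
  -- private copy of `exists_collar_mem` (p138126), codomain generalised
  by_contra! hcon
  choose y hylow hyle hyW using fun n : ℕ ↦ hcon (1 / ((n : ℝ) + 1)) (by positivity)
  -- the sequence is bounded
  set R : ℝ := √(rp ^ 2 + a ^ 2) with hR
  have hyR : ∀ n, y n ∈ Metric.closedBall (0 : E3) R := by
    intro n
    rw [Metric.mem_closedBall, dist_zero_right]
    have h1 := sq_spatialNorm_le_radius_sq_add_w3 a (E4.ofTimeSpace 0 (y n))
    rw [E4.spatialNorm_ofTimeSpace] at h1
    have h2 : Kerr.radius a (E4.ofTimeSpace 0 (y n)) ^ 2 ≤ rp ^ 2 :=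
      pow_le_pow_left₀ (Kerr.radius_nonneg a _) (hyle n) 2
    calc ‖y n‖ ≤ |‖y n‖| := le_abs_self _
      _ ≤ R := Real.abs_le_sqrt (by linarith)
  -- a convergent subsequence and its limit on the horizon
  obtain ⟨y₀, -, φ, hφ, hlim⟩ := tendsto_subseq_of_bounded Metric.isBounded_closedBall hyR
  set x₀ : E4 := E4.ofTimeSpace 0 y₀ with hx₀
  have hxlim : Tendsto (fun n ↦ E4.ofTimeSpace 0 (y (φ n))) atTop (𝓝 x₀) :=
    ((E4.continuous_ofTimeSpace 0).tendsto y₀).comp hlim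
  have hrlim : Tendsto (fun n ↦ Kerr.radius a (E4.ofTimeSpace 0 (y (φ n)))) atTop
      (𝓝 (Kerr.radius a x₀)) :=
    ((Kerr.continuous_radius a).tendsto x₀).comp hxlim
  have hεlim : Tendsto (fun n ↦ rp - 1 / ((φ n : ℝ) + 1)) atTop (𝓝 (rp - 0)) :=
    tendsto_const_nhds.sub (tendsto_one_div_add_atTop_nhds_zero_nat.comp hφ.tendsto_atTop)
  rw [sub_zero] at hεlim
  have hr₀ : Kerr.radius a x₀ = rp :=
    le_antisymm (le_of_tendsto' hrlim fun n ↦ hyle (φ n))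
      (le_of_tendsto_of_tendsto' hεlim hrlim fun n ↦ (hylow (φ n)).le)
  have hx₀S : x₀ ∈ (Kerr.region a r₁ : Set E4) := by
    show max r₁ 0 < Kerr.radius a x₀
    rw [hr₀]
    exact hr₁
  have hΘx₀ : Θ x₀ ∈ W := hhor x₀ hx₀S hr₀
  have hcont : ContinuousAt Θ x₀ := hΘc.continuousAt ((Kerr.region a r₁).isOpen.mem_nhds hx₀S)
  have hev : ∀ᶠ n in atTop, Θ (E4.ofTimeSpace 0 (y (φ n))) ∈ W :=
    (hcont.tendsto.comp hxlim).eventually_mem (hW.mem_nhds hΘx₀)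
  obtain ⟨n, hn⟩ := hev.exists
  exact hyW (φ n) hn

/-! ## §2 Time spreading: an infinitesimally `T`-equivariant map runs along the chart lines of `A` -/

section Spread

variable {𝓑 : StationaryAFBlackHole.{0}}

/-- The stationary Killing field is `C¹` as a section of `TM` (a Killing field of the `C^∞` metric
is `C^∞`; the Levi-Civita connection is the tree's `PseudoRiemannianMetric.hasLeviCivita`).
O'Neill 1983, Ch. 9, Def. 9.22. [folklore] -/
private theorem killing_contMDiff_one_w3 (𝓑 : StationaryAFBlackHole.{0}) :
    ContMDiff (𝓡 4) (𝓡 4).tangent 1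
      (fun x ↦ (⟨x, 𝓑.killing x⟩ : TangentBundle (𝓡 4) 𝓑.carrier)) := by
  haveI : 𝓑.metric.HasLeviCivita := 𝓑.metric.toPseudoRiemannianMetric.hasLeviCivita
  exact 𝓑.isStationaryKilling.isKillingField.contMDiff.of_le (WithTop.coe_le_coe.mpr le_top)

variable {S : Set E4} {Φ : E4 → 𝓑.carrier} {c : ℝ}

/-- **The reparametrised Kerr–Schild time line is an integral curve of `T`.** If `Φ` is `C^∞` on
the open time-translation invariant set `S` with `dΦ_x (e₀) = c T (Φ x)` there, `c ≠ 0`, then for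
`x ∈ S` the curve `s ↦ Φ (x + (s/c) e₀)` is a whole-line integral curve of `T` (chain rule:
its velocity is `(1/c) dΦ (e₀) = T`). O'Neill 1983, Ch. 1, p. 29 (integral curves). [folklore] -/
private theorem isMIntegralCurve_apply_add_smul (hSo : IsOpen S)
    (hS : ∀ x ∈ S, ∀ s : ℝ, x + s • E4.basisVector 0 ∈ S) (hc : c ≠ 0)
    (hΦs : ContMDiffOn 𝓘(ℝ, E4) (𝓡 4) ∞ Φ S)
    (hΦT : ∀ x ∈ S, mfderiv 𝓘(ℝ, E4) (𝓡 4) Φ x (E4.basisVector 0) = c • 𝓑.killing (Φ x))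
    {x : E4} (hx : x ∈ S) :
    IsMIntegralCurve (fun s : ℝ ↦ Φ (x + (s * c⁻¹) • E4.basisVector 0)) 𝓑.killing := by
  intro t
  have hxt : x + (t * c⁻¹) • E4.basisVector 0 ∈ S := hS x hx _
  have h1 : HasDerivAt (fun s : ℝ ↦ x + (s * c⁻¹) • E4.basisVector 0)
      ((1 * c⁻¹) • E4.basisVector 0) t :=
    (((hasDerivAt_id t).mul_const c⁻¹).smul_const (E4.basisVector 0)).const_add x
  rw [one_mul] at h1
  have h2 : HasMFDerivAt 𝓘(ℝ, ℝ) 𝓘(ℝ, E4) (fun s : ℝ ↦ x + (s * c⁻¹) • E4.basisVector 0) t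
      ((1 : ℝ →L[ℝ] ℝ).smulRight (c⁻¹ • E4.basisVector 0)) :=
    hasMFDerivAt_iff_hasFDerivAt.2 h1.hasFDerivAt
  have h3 : HasMFDerivAt 𝓘(ℝ, E4) (𝓡 4) Φ (x + (t * c⁻¹) • E4.basisVector 0)
      (mfderiv 𝓘(ℝ, E4) (𝓡 4) Φ (x + (t * c⁻¹) • E4.basisVector 0)) :=
    ((hΦs.contMDiffAt (hSo.mem_nhds hxt)).mdifferentiableAt (by simp)).hasMFDerivAt
  have h4 := h3.comp t h2
  refine h4.congr_mfderiv ?_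
  apply ContinuousLinearMap.ext_ring
  change mfderiv 𝓘(ℝ, E4) (𝓡 4) Φ (x + (t * c⁻¹) • E4.basisVector 0)
      ((1 : ℝ) • (c⁻¹ • E4.basisVector 0)) =
    (1 : ℝ) • 𝓑.killing (Φ (x + (t * c⁻¹) • E4.basisVector 0))
  have h5 : mfderiv 𝓘(ℝ, E4) (𝓡 4) Φ (x + (t * c⁻¹) • E4.basisVector 0) (c⁻¹ • E4.basisVector 0) =
      c⁻¹ • mfderiv 𝓘(ℝ, E4) (𝓡 4) Φ (x + (t * c⁻¹) • E4.basisVector 0) (E4.basisVector 0) :=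
    (mfderiv 𝓘(ℝ, E4) (𝓡 4) Φ (x + (t * c⁻¹) • E4.basisVector 0)).map_smul c⁻¹ (E4.basisVector 0)
  rw [one_smul, one_smul, h5, hΦT _ hxt, smul_smul, inv_mul_cancel₀ hc, one_smul]

/-- **Time spreading.** Under the same hypotheses, if `Φ x ∈ range A` for an adapted chart `A`, then
`Φ (x + s e₀) ∈ range A` for every `s`: with `A u = Φ x`, the curve `s ↦ Φ (x + (s/c) e₀)` and the
chart line `s ↦ A (u + s e₀)` (`isMIntegralCurve_adaptedChart_line`) are whole-line integral curves
of the `C¹` field `T` through the same point of the Hausdorff boundaryless carrier, hence equal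
(uniqueness of integral curves, Mathlib `isMIntegralCurve_Ioo_eq_of_contMDiff_boundaryless`).
Lee 2013, Thm. 9.12; O'Neill 1983, Ch. 1, Lemma 1.56 ff. [folklore] -/
private theorem apply_add_smul_mem_range (A : 𝓑.AdaptedChart) (hSo : IsOpen S)
    (hS : ∀ x ∈ S, ∀ s : ℝ, x + s • E4.basisVector 0 ∈ S) (hc : c ≠ 0)
    (hΦs : ContMDiffOn 𝓘(ℝ, E4) (𝓡 4) ∞ Φ S)
    (hΦT : ∀ x ∈ S, mfderiv 𝓘(ℝ, E4) (𝓡 4) Φ x (E4.basisVector 0) = c • 𝓑.killing (Φ x))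
    {x : E4} (hx : x ∈ S) (hΦx : Φ x ∈ Set.range A.toFun) (s : ℝ) :
    Φ (x + s • E4.basisVector 0) ∈ Set.range A.toFun := by
  obtain ⟨hu, hAu⟩ := chartPreimage_spec A hΦx
  have hγ₁ := isMIntegralCurve_apply_add_smul hSo hS hc hΦs hΦT hx
  have hγ₂ := isMIntegralCurve_adaptedChart_line A hu
  have he : (⟨chartPreimage A (Φ x) + (0 : ℝ) • E4.basisVector 0,
      add_smul_basisVector_mem_domain A hu 0⟩ : A.domain) = ⟨chartPreimage A (Φ x), hu⟩ :=
    Subtype.ext (by simp)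
  have h0 : (fun s : ℝ ↦ Φ (x + (s * c⁻¹) • E4.basisVector 0)) 0 =
      (fun s : ℝ ↦ A.toFun ⟨chartPreimage A (Φ x) + s • E4.basisVector 0,
        add_smul_basisVector_mem_domain A hu s⟩) 0 := by
    show Φ (x + ((0 : ℝ) * c⁻¹) • E4.basisVector 0) =
      A.toFun ⟨chartPreimage A (Φ x) + (0 : ℝ) • E4.basisVector 0,
        add_smul_basisVector_mem_domain A hu 0⟩
    rw [he, hAu, zero_mul, zero_smul, add_zero]
  have heq := isMIntegralCurve_Ioo_eq_of_contMDiff_boundaryless (t₀ := 0)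
    (killing_contMDiff_one_w3 𝓑) hγ₁ hγ₂ h0
  have h := congrFun heq (s * c)
  have h' : Φ (x + (s * c * c⁻¹) • E4.basisVector 0) =
      A.toFun ⟨chartPreimage A (Φ x) + (s * c) • E4.basisVector 0,
        add_smul_basisVector_mem_domain A hu (s * c)⟩ := h
  rw [mul_inv_cancel_right₀ hc] at h'
  rw [h']
  exact Set.mem_range_self _

end Spread

/-! ## §3 The registered reduction: F3a″ (intrinsic extension across the horizon) implies F3 -/

/-- **Registered helper `kerrHorizonExtension_of_intrinsicExtension`** (the intrinsic, chart-free
form of the soft half of stub 1R-F3). HYPOTHESIS F3a″ (inline premise): under the hypotheses of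
`KerrHorizonExtension` (telescope hole `𝓑`, `I⁺`-regular, horizon-covering asymptotically Cartesian
adapted chart `A`, sub-extremal `(M, a)`, `c > 0`, `Ψ` an injective isometric immersion of the Kerr
exterior onto the d.o.c. with `dΨ (∂_{t*}) = c T`), `Ψ` extends to `Φ₀ : E4 → 𝓑` which on some
horizon-penetrating Kerr–Schild region `{r > r₁}`, `r₁ < r₊`, is `C^∞`, injective, infinitesimally
`T`-equivariant (`dΦ₀ e₀ = c T ∘ Φ₀`), agrees with `Ψ` on the exterior, and sends Kerr's future
horizon `{r = r₊}` into the future event horizon `𝓑.horizon = 𝓔⁺` — i.e. the boundary regularity of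
the d.o.c. isometry at `𝓔⁺` read intrinsically in `𝓑`. CONCLUSION: `KerrHorizonExtension`. Proof:
`𝓔⁺ ⊆ range A` (hypothesis of F3) and `range A` open give, by the collar lemma `exists_collar_mem'`,
a charted slice collar `Φ₀ {x⁰ = 0, r₊ − ε < r ≤ r₊} ⊆ range A`; time spreading along the integral
curves of `T` (`apply_add_smul_mem_range`) and time invariance of the Kerr–Schild radius extend this
to all `x⁰`; exterior points are charted since `Ψ (exterior) = doc ⊆ range A`
(`AdaptedChart.doc_subset_range`); with `r₀ := max (r₁, (r₋ + r₊)/2, r₊ − ε)` the remaining clauses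
are restrictions of the F3a″ data. Chruściel–Costa arXiv:0806.0016, Thm. 1.3 with §4.3 (shape of
F3); O'Neill 1983, Ch. 1, Lemma 1.56 ff.; Lee 2013, Thm. 9.12. [folklore] -/
theorem kerrHorizonExtension_of_intrinsicExtension : (∀ [Kerr.Facts] (𝓑 : StationaryAFBlackHole.{0}) (A : 𝓑.AdaptedChart) (M a c : ℝ) (Ψ : Kerr.exterior M a → 𝓑.carrier), InTelescope 𝓑 → 𝓑.IsIPlusRegular → 𝓑.horizon ⊆ Set.range A.toFun → ChartIsAsymptoticallyCartesian A → Kerr.IsSubextremal M a → 0 < c → Function.Injective Ψ → Set.range Ψ = 𝓑.doc → PseudoRiemannianMetric.IsIsometricImmersion (Kerr.smoothMetric M a (Kerr.rPlus M a)).toPseudoRiemannianMetric 𝓑.metric.toPseudoRiemannianMetric Ψ → (∀ x : Kerr.exterior M a, mfderiv 𝓘(ℝ, E4) (𝓡 4) Ψ x (E4.basisVector 0) = c • 𝓑.killing (Ψ x)) → ∃ (r₁ : ℝ) (Φ₀ : E4 → 𝓑.carrier), r₁ < Kerr.rPlus M a ∧ ContMDiffOn 𝓘(ℝ, E4) (𝓡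 4) ∞ Φ₀ (Kerr.region a r₁ : Set E4) ∧ Set.InjOn Φ₀ (Kerr.region a r₁ : Set E4) ∧ (∀ x ∈ (Kerr.region a r₁ : Set E4), mfderiv 𝓘(ℝ, E4) (𝓡 4) Φ₀ x (E4.basisVector 0) = c • 𝓑.killing (Φ₀ x)) ∧ (∀ x ∈ (Kerr.region a r₁ : Set E4), Kerr.radius a x = Kerr.rPlus M a → Φ₀ x ∈ 𝓑.horizon) ∧ (∀ x : Kerr.exterior M a, Φ₀ x.1 = Ψ x)) → KerrHorizonExtension := by
  intro hF3a hKF 𝓑 A M a c Ψ htel hreg hhor hcart hMa hc hΨi hΨr hΨiso hΨT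
  obtain ⟨r₁, Φ₀, hr₁, hΦs, hΦi, hΦT, hΦhor, hΦΨ⟩ :=
    hF3a 𝓑 A M a c Ψ htel hreg hhor hcart hMa hc hΨi hΨr hΨiso hΨT
  -- elementary facts on the radii and the regions
  have hrp0 : 0 < Kerr.rPlus M a := hMa.rMinus_nonneg.trans_lt hMa.rMinus_lt_rPlus
  have hr₁' : max r₁ 0 < Kerr.rPlus M a := max_lt hr₁ hrp0
  have hS₁o : IsOpen (Kerr.region a r₁ : Set E4) := (Kerr.region a r₁).isOpen
  have hRo : IsOpen (Set.range A.toFun) := A.isOpenEmbedding.isOpen_range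
  -- exterior points are charted: `Φ₀ x = Ψ x ∈ doc ⊆ range A`
  have hext : ∀ x : Kerr.exterior M a, Φ₀ x.1 ∈ Set.range A.toFun := by
    intro x
    rw [hΦΨ x]
    refine A.doc_subset_range ?_
    rw [← hΨr]
    exact Set.mem_range_self x
  -- Step 1: a collar of the horizon on the slice `{x⁰ = 0}` is charted (`𝓔⁺ ⊆ range A` open)
  obtain ⟨ε, hε, hcollar⟩ := exists_collar_mem' hRo hr₁' hΦs.continuousOn
    fun x hx hr ↦ hhor (hΦhor x hx hr)
  -- Step 2: the inner radius `r₀`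
  set r₀ : ℝ := max (max r₁ ((Kerr.rMinus M a + Kerr.rPlus M a) / 2)) (Kerr.rPlus M a - ε)
    with hr₀_def
  have hr₀lt : r₀ < Kerr.rPlus M a := by
    rw [hr₀_def]
    exact max_lt (max_lt hr₁ (by linarith [hMa.rMinus_lt_rPlus])) (by linarith)
  have hr₀m : Kerr.rMinus M a < r₀ := by
    rw [hr₀_def]
    exact lt_of_lt_of_le (by linarith [hMa.rMinus_lt_rPlus]) ((le_max_right _ _).trans (le_max_left _ _))
  have hr₁₀ : r₁ ≤ r₀ := by
    rw [hr₀_def]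
    exact (le_max_left _ _).trans (le_max_left _ _)
  have hε₀ : Kerr.rPlus M a - ε ≤ r₀ := by
    rw [hr₀_def]
    exact le_max_right _ _
  have hsub : (Kerr.region a r₀ : Set E4) ⊆ (Kerr.region a r₁ : Set E4) := Kerr.region_mono a hr₁₀
  -- Step 3: `Φ₀ {r > r₀} ⊆ range A` (exterior: `doc ⊆ range A`; collar: Step 1 + time spreading)
  have hmaps : Set.MapsTo Φ₀ (Kerr.region a r₀ : Set E4) (Set.range A.toFun) := by
    intro x hx
    by_cases hxr : Kerr.rPlus M a < Kerr.radius a x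
    · exact hext ⟨x, Kerr.mem_exterior.2 (max_lt hxr (Kerr.radius_pos_of_mem_region hx))⟩
    · have hxr' : Kerr.radius a x ≤ Kerr.rPlus M a := not_lt.mp hxr
      -- the foot `(0, y)` of `x = (t, y)` has the same radius and is charted by Step 1
      have hrad := Kerr.radius_add_time_smul_basisVector a (E4.ofTimeSpace 0 (E4.spatial x)) (E4.time x)
      rw [ofTimeSpace_zero_spatial_add_time_smul] at hrad
      have hfoot : E4.ofTimeSpace 0 (E4.spatial x) ∈ (Kerr.region a r₁ : Set E4) :=
        ofTimeSpace_zero_spatial_mem (kerrRegion_add_smul_mem a r₁) (hsub hx)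
      have h0 : Φ₀ (E4.ofTimeSpace 0 (E4.spatial x)) ∈ Set.range A.toFun := by
        refine hcollar (E4.spatial x) ?_ ?_
        · rw [← hrad]
          linarith [Kerr.lt_radius_of_mem_region hx]
        · rw [← hrad]
          exact hxr'
      have h := apply_add_smul_mem_range A hS₁o (kerrRegion_add_smul_mem a r₁) hc.ne' hΦs hΦT hfoot
        h0 (E4.time x)
      rwa [ofTimeSpace_zero_spatial_add_time_smul] at h
  exact ⟨r₀, Φ₀, hr₀m, hr₀lt, hΦs.mono hsub, hΦi.mono hsub, hmaps, fun x hx ↦ hΦT x (hsub hx), hΦΨ⟩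

end Summit.FinalStateConjecture.FinalStateConjecture.Theorems.SymplecticDualOfTheBomb

end
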